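/-
Origin: expansion seat `planner-pub-hodgecm-pv12-g2-0`, handover 2026-08-18 (`HOME/pub-hodgecm-pv12-g2/lean/Pv12g2/ArchCFockSmoke.lean`, md5 6252b5d9, 201 lines);
landed by the gen-6 packager in gate run 22 as `HodgeCM/PerL34/ArchCFockSmoke.lean` (import ^import Pv[0-9]+g[0-9]+\.→import HodgeCM.PerL34. ×1).
-/
/-
Origin: HOME/pub-hodgecm-pv12-g2/lean/Pv12g2/ArchCFockSmoke.lean — session planner-pub-hodgecm-pv12-g2-0 (unit
pub-hodgecm-pv12-g2).  OPTIONAL vacuity guard for `ArchCFock.lean` (seam S4, D5 constructor); nothing imports it.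
Intended final place: `HodgeCM/PerL34/ArchCFockSmoke.lean` (the WIP import `Pv12g2.ArchCFock` ↦
`HodgeCM.PerL34.ArchCFock`).  Asserts nothing: no axiom, no placeholder proof.
-/
import Summits.HodgeConjecture.HodgeCM.PerL34.ArchCFock_2

set_option autoImplicit false
set_option linter.unusedSectionVars false

/-!
# Vacuity guard for the Fock bridge of seam S4: `φ⁰ = ⊗_b φ⁰_b ≠ 0` in the intended local models

Referee question (standing, referees 2/3/adv): can the record `Fock.LocalFock` / `Fock.FockPlaces` of `ArchCFock.lean` be
instantiated DEGENERATELY (φ⁰_b = 0, so that `gen`/`eigen` hold for nothing)?  The record allows it on purpose (see the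
VACUITY NOTE there); this file shows that the INTENDED constructors are non-degenerate and that non-degeneracy
propagates through the finite tensor product — all KERNEL (Mathlib `PiTensorProduct.lift`, `MultilinearMap.mkPiAlgebra`):

* `Fock.prodFunctional ℓ` = ⊗_b ℓ_b : (⨂[ℂ] b, M b) →ₗ ℂ, `prodFunctional_tprod : (⊗ ℓ)(⊗ m) = ∏ ℓ_b(m_b)`;
  `Fock.tprod_ne_zero_of_functionals`: local functionals non-zero on `m b` ⇒ `⨂ₜ m ≠ 0`;
  `FockPlaces.φ₀_ne_zero`: every local φ⁰_b detected by a functional ⇒ the joint `φ₀ ≠ 0`.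
* the intended local models are detected: `LocalFock.ofLine_nondeg` (any line ℂ·v, v ≠ 0: the coordinate `coord`),
  hence `ofE_nondeg` (φ⁰ = 1 ∈ ℂ[M_{3×2}]) and `ofI_nondeg`; `ofIcol_nondeg` (φ⁰ = det(z): the coefficient of
  z₀₀z₁₁ is 1, `coeff_detZ`); `ofM_nondeg` (φ⁰ = 1 ∈ ℂ[P]: constant coefficient).
* a TOY signature with one real place of each sign type (E, M, I), the M-place carrying the genuine raising operator
  `c_b·(P·_)` (`c_b ≠ 0`) of tex ll. 503–504: `Fock.Toy.places cb hcb : FockPlaces` with `Toy.φ₀_ne_zero` AND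
  `Toy.isGeneratedBy` (the kernel generation theorem applied) — so the hypotheses of `FockArchBridge.toArchCDatum`'s
  Fock layer are jointly satisfiable with φ⁰ ≠ 0.
-/

noncomputable section

open Function
open scoped TensorProduct

namespace HodgeCM
namespace PerL34
namespace Fock

/-! ## The product functional and non-vanishing of pure tensors -/

section ProdFunctional

variable {RP : Type*} [Fintype RP]
variable {M : RP → Type*} [∀ b, AddCommGroup (M b)] [∀ b, Module ℂ (M b)]

/-- `⊗_b ℓ_b : (⨂[ℂ] b, M b) →ₗ[ℂ] ℂ` for local functionals `ℓ b : M b →ₗ[ℂ] ℂ`. -/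
def prodFunctional (ℓ : ∀ b, M b →ₗ[ℂ] ℂ) : (⨂[ℂ] b, M b) →ₗ[ℂ] ℂ :=
  PiTensorProduct.lift ((MultilinearMap.mkPiAlgebra ℂ RP ℂ).compLinearMap ℓ)

/-- (Ported verbatim from the HodgeCMPerL package; no docstring in the source.) -/
theorem prodFunctional_tprod (ℓ : ∀ b, M b →ₗ[ℂ] ℂ) (m : Π b, M b) :
    prodFunctional ℓ (PiTensorProduct.tprod ℂ m) = ∏ b, ℓ b (m b) := by
  rw [prodFunctional, PiTensorProduct.lift.tprod, MultilinearMap.compLinearMap_apply,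
    MultilinearMap.mkPiAlgebra_apply]

/-- A pure tensor whose factors are detected by linear functionals is non-zero. -/
theorem tprod_ne_zero_of_functionals (m : Π b, M b) (ℓ : ∀ b, M b →ₗ[ℂ] ℂ) (h : ∀ b, ℓ b (m b) ≠ 0) :
    PiTensorProduct.tprod ℂ m ≠ 0 := by
  intro h0
  have key := prodFunctional_tprod ℓ m
  rw [h0, map_zero] at key
  exact Finset.prod_ne_zero_iff.mpr (fun b _ => h b) key.symm

end ProdFunctional

/-- **The joint φ⁰ = ⊗_b φ⁰_b is non-zero** as soon as every local φ⁰_b is detected by a linear functional. -/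
theorem FockPlaces.φ₀_ne_zero (pl : FockPlaces)
    (h : ∀ b, ∃ ℓ : (pl.loc b).M →ₗ[ℂ] ℂ, ℓ (pl.loc b).φ ≠ 0) : pl.φ₀ ≠ 0 := by
  choose ℓ hℓ using h
  exact tprod_ne_zero_of_functionals (fun b => (pl.loc b).φ) ℓ hℓ

/-! ## The intended local models are non-degenerate -/

namespace LocalFock

section Line

variable {V : Type} [AddCommGroup V] [Module ℂ V]

/-- On a line `ℂ·v` with `v ≠ 0` the coordinate functional detects the generator. -/
theorem ofLine_nondeg (v : V) (hv : v ≠ 0) {ι : Type}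
    (X : ι → ↥(Submodule.span ℂ ({v} : Set V)) →ₗ[ℂ] ↥(Submodule.span ℂ ({v} : Set V)))
    (T : Type) [Group T]
    (ω : T → ↥(Submodule.span ℂ ({v} : Set V)) →ₗ[ℂ] ↥(Submodule.span ℂ ({v} : Set V))) :
    ∃ ℓ : (ofLine v X T ω).M →ₗ[ℂ] ℂ, ℓ (ofLine v X T ω).φ ≠ 0 := by
  refine ⟨(LinearEquiv.coord ℂ V v hv).toLinearMap, ?_⟩
  show (LinearEquiv.coord ℂ V v hv) ⟨v, Submodule.mem_span_singleton_self v⟩ ≠ 0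
  rw [LinearEquiv.coord_self]
  exact one_ne_zero

end Line

/-- Case E: φ⁰_b = 1 ≠ 0 in ℂ[M_{3×2}]. -/
theorem ofE_nondeg {ι : Type} (X : ι → ↥kappaPartE →ₗ[ℂ] ↥kappaPartE) (T : Type) [Group T]
    (ω : T → ↥kappaPartE →ₗ[ℂ] ↥kappaPartE) :
    ∃ ℓ : (ofE X T ω).M →ₗ[ℂ] ℂ, ℓ (ofE X T ω).φ ≠ 0 :=
  ofLine_nondeg (V := EqModel) 1 one_ne_zero X T ω

/-- `det(z) ≠ 0`: its `z₀₀z₁₁`-coefficient is `1` (`coeff_detZ`, `μ_injective`). -/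
theorem coeff_μ01_detZ : MvPolynomial.coeff (μ 0 1) detZ = 1 := by
  have hne : μ 1 0 ≠ μ 0 1 := by
    intro h
    have := μ_injective (a₁ := (1, 0)) (a₂ := (0, 1)) h
    simp at this
  rw [coeff_detZ, if_pos rfl, if_neg hne, sub_zero]

/-- (Ported verbatim from the HodgeCMPerL package; no docstring in the source.) -/
theorem detZ_ne_zero : detZ ≠ 0 := by
  intro h
  have := coeff_μ01_detZ
  rw [h, MvPolynomial.coeff_zero] at this
  exact zero_ne_one this

/-- Case I (line form): φ⁰ = det(z) ≠ 0. -/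
theorem ofI_nondeg {ι : Type} (X : ι → ↥kappaPartI →ₗ[ℂ] ↥kappaPartI) (T : Type) [Group T]
    (ω : T → ↥kappaPartI →ₗ[ℂ] ↥kappaPartI) :
    ∃ ℓ : (ofI X T ω).M →ₗ[ℂ] ℂ, ℓ (ofI X T ω).φ ≠ 0 :=
  ofLine_nondeg (V := PlaneModel) detZ detZ_ne_zero X T ω

/-- Case I (column action): φ⁰ = det(z) is detected by the `z₀₀z₁₁`-coefficient. -/
theorem ofIcol_nondeg {ι : Type} (X : ι → ↥kappaPartI →ₗ[ℂ] ↥kappaPartI) (T : Type) [Group T] (vac : T → ℂ)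
    (g : T → Matrix (Fin 2) (Fin 2) ℂ) :
    ∃ ℓ : (ofIcol X T vac g).M →ₗ[ℂ] ℂ, ℓ (ofIcol X T vac g).φ ≠ 0 := by
  refine ⟨(MvPolynomial.lcoeff ℂ (μ 0 1)).comp kappaPartI.subtype, ?_⟩
  show MvPolynomial.lcoeff ℂ (μ 0 1) detZ ≠ 0
  rw [MvPolynomial.lcoeff_apply, coeff_μ01_detZ]
  exact one_ne_zero

/-- Case M: φ⁰_b = 1 ∈ ℂ[P] is detected by the constant coefficient. -/
theorem ofM_nondeg {ι : Type} (X : ι → ↥kappaPartM →ₗ[ℂ] ↥kappaPartM) (cb : ℂ) (hcb : cb ≠ 0) (k₀ : ι)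
    (hX : ∀ φ : ↥kappaPartM, ((X k₀ φ : ↥kappaPartM) : MixedModel) = cb • (P * φ))
    (T : Type) [Group T] (vac : T → ℂ) (π : T → (MixedModel →ₐ[ℂ] MixedModel))
    (hπ : ∀ t, ∀ f ∈ kappaPartM, (π t).toLinearMap f ∈ kappaPartM) :
    ∃ ℓ : (ofM X cb hcb k₀ hX T vac π hπ).M →ₗ[ℂ] ℂ, ℓ (ofM X cb hcb k₀ hX T vac π hπ).φ ≠ 0 := by
  refine ⟨(MvPolynomial.lcoeff ℂ 0).comp kappaPartM.subtype, ?_⟩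
  show MvPolynomial.lcoeff ℂ 0 (1 : MixedModel) ≠ 0
  rw [MvPolynomial.lcoeff_apply, MvPolynomial.coeff_zero_one]
  exact one_ne_zero

end LocalFock

/-! ## A toy signature: one real place of each sign type, with the genuine raising operator at the M-place -/

namespace Toy

/-- The three sign types of a real place b (N13 `lemma33b_signs`): equal signs (D₁₂), mixed (Σ₁₂), the place ι₁. -/
inductive Sign : Type
  | E | M | I
  deriving DecidableEq

/-- (Ported verbatim from the HodgeCMPerL package; no docstring in the source.) -/
instance : Fintype Sign where
  elems := {Sign.E, Sign.M, Sign.I}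
  complete := by intro x; cases x <;> simp

/-- The raising operator `c_b·(P·_)` on `ℂ[P]` (tex ll. 503–504), as the one-member family at the M-place. -/
def raise (cb : ℂ) : Unit → ↥kappaPartM →ₗ[ℂ] ↥kappaPartM :=
  fun _ => cb • (LinearMap.mulLeft ℂ P).restrict fun _ hf => P_mul_mem_kappaPartM hf

/-- (Ported verbatim from the HodgeCMPerL package; no docstring in the source.) -/
theorem raise_apply (cb : ℂ) (φ : ↥kappaPartM) :
    ((raise cb () φ : ↥kappaPartM) : MixedModel) = cb • (P * φ) := rfl

/-- The toy local models: E and I with the empty operator family and the trivial torus; M with the raising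
operator, trivial torus acting through `AlgHom.id` with vacuum character `1`. -/
def loc (cb : ℂ) (hcb : cb ≠ 0) : Sign → LocalFock
  | .E => LocalFock.ofE (ι := Empty) Empty.elim Unit fun _ => LinearMap.id
  | .M => LocalFock.ofM (raise cb) cb hcb () (raise_apply cb) Unit (fun _ => 1) (fun _ => AlgHom.id ℂ MixedModel)
      fun _ _ hf => hf
  | .I => LocalFock.ofIcol (ι := Empty) Empty.elim Unit (fun _ => 1) fun _ => 1

/-- **Toy `FockPlaces`**: three real places, one of each sign type. -/
def places (cb : ℂ) (hcb : cb ≠ 0) : FockPlaces where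
  RP := Sign
  loc := loc cb hcb

/-- Its joint φ⁰ = 1 ⊗ 1 ⊗ det(z) is NON-ZERO. -/
theorem φ₀_ne_zero (cb : ℂ) (hcb : cb ≠ 0) : (places cb hcb).φ₀ ≠ 0 := by
  refine (places cb hcb).φ₀_ne_zero fun b => ?_
  cases b with
  | E => exact LocalFock.ofE_nondeg (ι := Empty) Empty.elim Unit fun _ => LinearMap.id
  | M =>
    exact LocalFock.ofM_nondeg (raise cb) cb hcb () (raise_apply cb) Unit (fun _ => 1)
      (fun _ => AlgHom.id ℂ MixedModel) fun _ _ hf => hf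
  | I => exact LocalFock.ofIcol_nondeg (ι := Empty) Empty.elim Unit (fun _ => 1) fun _ => 1

/-- … and GENERATES the joint κ-part under the slot operators (the kernel theorem `FockPlaces.isGeneratedBy`,
here fed by `isGeneratedBy_E`, `isGeneratedBy_M` with the genuine raising operator, `isGeneratedBy_I`). -/
theorem isGeneratedBy (cb : ℂ) (hcb : cb ≠ 0) : IsGeneratedBy (places cb hcb).X (places cb hcb).φ₀ :=
  (places cb hcb).isGeneratedBy

/-- … and is a joint eigenvector of the (toy, trivial) torus with the product character. -/
theorem ωT_φ₀ (cb : ℂ) (hcb : cb ≠ 0) (t : (places cb hcb).Tg) :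
    (places cb hcb).ωT t (places cb hcb).φ₀ = (places cb hcb).χ t • (places cb hcb).φ₀ :=
  (places cb hcb).ωT_φ₀ t

end Toy

end Fock
end PerL34
end HodgeCM

end
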